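import Literature.MathematicalPhysics.QuantumFieldTheory.Balaban1983to89.B9Eq3152RkGpDstarPiTwoBackgroundHolderLetter
import Literature.MathematicalPhysics.QuantumFieldTheory.Balaban1983to89.B11Eq117FrakGkPiLetterDefectAtFlatOfOmegaHolder
import Literature.MathematicalPhysics.QuantumFieldTheory.Balaban1983to89.B11Eq174ChartLipschitzAtFlatLatticeFreeOfOmegaHolder

/-!
# `Balaban1983to89.B11Eq174ChartLipschitzAtFlatLatticeFreeClosed` — T. Bałaban, *The variational problem and background fields in renormalization group method for lattice gauge theories*, CMP **102** (1985) 277–309 [Balaban1985Variational] Prop. 6 (116)–(121) p. 295, (174)–(175) p. 305, Prop. 9 p. 309, (47) p. 284, with [Balaban1985BackgroundPropagators] Thm 3.4 p. 400, (3.122) p. 420: **THE LETTER DEFECT `δ̃_G` OF `𝔊̃_k` AND THE CHART (174) LIPSCHITZ IN THE BACKGROUND AT THE FLAT POINT, LATTICE-FREE, UNCONDITIONAL** (gen 102∕103's conditional theorems, `Hω` discharged).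
# The located FIRST-ORDER letter `Hω` (η-scale ½-Hölder row of `ω(U) − ω(1)`, `ω = R_kG′_kD*_Uf`, small factor `(j₀ + α)`) is now IN THE TREE:
# `B9Eq3152RkGpDstarPiTwoBackgroundHolderLetter.exists_holderLetter_RkGpDstar_sub_flat` (this lineage, gen 104).  This file is the pure composition BY NAME of gen 103's conditional
# theorems (`…OfOmegaHolder`) with it: statements VERBATIM, the hypothesis `Hω` DISCHARGED — ROUTE (J′) of the NE9 crux team at the flat point, unconditional on the model.
# NE9 crux-team LEAF PROVER 01 (`b2b-balaban-t4-ne9-formalise-leaf-01`), gen 104; audit cell `pub-balaban`, sub-cell `t4`, BINDER row NE9, bears_on R4/N22.  [folklore] composition; source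
# pages as in the composed files (T. Bałaban, CMP **99** (1985) 389–434 [Balaban1985BackgroundPropagators] pp. 396–403, 419–420, 425–426; CMP **102** (1985) 277–309 [Balaban1985Variational]
# pp. 284, 294–295, 305, 309).

statement-level skeleton of published theorems with citation tags; proofs where landed; nothing here is a claim about the Yang–Mills mass gap

WHAT IS PROVED (sorry-free; proof lane — 0 `def`): `exists_frakGkPi_letterDefect_at_flat`, `exists_chart_arg_lipschitz_at_flat_latticeFree`, `exists_chartHB_lipschitz_at_flat_latticeFree`.
HONEST SCOPE.  Composition BY NAME on the cell's MODEL rows (O-NE9-1, #5 UNRULED); constants crude; `j₀` and `α` displayed separately; the windows, `c₀ = η^d`, unitarity, the tower data, the positivity and onto witnesses stay HYPOTHESES; nothing of [B9] (3.43)–(3.44), (3.152)–(3.153), Thm 3.1∕3.4∕3.13 or [B11] (117), (174) asserted as printed; «NE9 ⇐ the named binders»; NE9 NOT PRINTED ∕ NOT PROVED; spine PROVED 0∕9; rung (B)+1 finite T⁴ — NOT infinite volume, NOT mass gap, NOT BetaPertH, NOT Clay.  HONEST DEPENDENCY: continuum YM on T⁴ ⇐ BetaPertH ∧ nine spine estimates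 (0/9 proved); BetaPertH ⇐ (D1) ∧ (D4) ∧ CAP+tail; G-an2-4 gates asym, D1 and NE2/3/4.  NEW file; nothing modified.  Net new unproved facts: 0.
-/

noncomputable section

open scoped InnerProductSpace ComplexConjugate BigOperators

namespace Literature.MathematicalPhysics.QuantumFieldTheory.Balaban1983to89.B11Eq174ChartLipschitzAtFlatLatticeFreeClosed

open B4Sect5Torus (TSite tdist)
open B9SectCLatticeCarrier (Bond bpos btgt shift unshift)
open B9Eq319QprimeTorus (blockCoord)
open B9Eq316TowerFlatIsOneStep (towerP_eq_fineP_pow siteCast)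
open B9Eq311L2Pairing (WL2)
open B7Prop1Explicit (U1 Wcx boxVec)
open B11Eq103H1Complex (SiteL2K BondL2K covDerivL2K covDivL2K G1LatticeK KinvLatticeK frakGLatticeK frakGLatticeCLM readFun)
open B11Eq115Space (NegSize Space115 levWeight NegSup JetSup)
open B11Eq111FrakG (nabla115 jetLinearEquiv toCLM115 toCLM115_apply)
open B9Eq33CovDerivVector (covGrad)
open B9Eq310DeltaPrime (plaqHolU)
open B9Eq310HessianOperator (adTransportW hessOp)
open B9Eq315QTorus (perCfg cornerSite)
open B9Eq315QTower (towerP UlevOf)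
open B9Eq315QTowerFlat (perCfg_UlevOf_one_mem_U1 norm_Wcx_UlevOf_one_sub_one_le)
open B9Eq326OperatorTower (laplaceAk QkW RofUk G1k)
open B9Eq324DeltaPrimeATower (laplacePrimeAk GpOfUk)
open B11Eq117LetterDefects (jetId_frakG_eq_toCLM115_readFun frakG_eq_toCLM115_readFun readFun_sub)
open B11Eq117ReadLettersBridge (norm_toCLM115_readFun_le_of_global)
open B9Eq3119DeltaPiTower (laplaceAkPi)
open B9Eq3153FrakGkPiTwoBackgroundLetterTower (exists_supRow_frakGkPi_sub_flat)
open B9Eq3153FrakGkPiTwoBackgroundGradientRowOfThirdWord (exists_supGradRow_frakGkPi_sub_flat_of_thirdWord)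
open B9Eq3152ThirdWordPiTwoBackgroundGradLetterOfOmegaHolder (exists_gradLetter_thirdWordPi_sub_flat_of_omegaHolder)
open B11Eq117FrakGkPiLetterDefectAtFlatOfGradRow (exists_frakGkPi_letterDefect_at_flat_of_thirdWordGradLetter)
open B11Eq115Space B11Eq111FrakG B11Eq103H1Complex
open B11Eq174Chart (Regime solA)
open B11Eq120SolutionContinuity (norm_map_arg_sub_arg_le)
open B11Eq117H1kPiLetterDefectAtFlatLatticeFree (exists_H1kPi_letterDefect_at_flat_latticeFree)
open B11Eq174ChartArgLipschitzAtFlatLatticeFreeOfThirdWord (exists_chart_arg_lipschitz_at_flat_latticeFree_of_thirdWord)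
open B11Eq174ChartHBLipschitzAtFlatLatticeFreeOfThirdWord (exists_chartHB_lipschitz_at_flat_latticeFree_of_thirdWord)
open B11Eq174Chart (Regime solA chartHB)
open B11Eq44CLetterTower (Cck)
open B11Eq120SolutionContinuity (norm_map_chartHB_sectC_sub_le)
open B9Eq3152RkGpDstarPiTwoBackgroundHolderLetter (exists_holderLetter_RkGpDstar_sub_flat)
open B11Eq117FrakGkPiLetterDefectAtFlatOfOmegaHolder (exists_frakGkPi_letterDefect_at_flat_of_omegaHolder)
open B11Eq174ChartLipschitzAtFlatLatticeFreeOfOmegaHolder (exists_chart_arg_lipschitz_at_flat_latticeFree_of_omegaHolder exists_chartHB_lipschitz_at_flat_latticeFree_of_omegaHolder)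

variable {d : ℕ} (hd : 1 ≤ d) (L : ℕ) [NeZero L] (hL : 1 ≤ L) (hL3 : 3 ≤ L)
  {𝔸 : Type*} [NormedRing 𝔸] [NormedAlgebra ℂ 𝔸] [CompleteSpace 𝔸] [NormOneClass 𝔸] [StarRing 𝔸] [NormedStarGroup 𝔸] [StarModule ℂ 𝔸] [FiniteDimensional ℂ 𝔸]
  {W : Type*} [NormedAddCommGroup W] [InnerProductSpace ℂ W] [FiniteDimensional ℂ W] (φ : W ≃ₗ[ℂ] 𝔸)
  {Mφ Mφ' : ℝ} (hMφ : 0 ≤ Mφ) (hMφ' : 0 ≤ Mφ') (hφ : ∀ w, ‖φ w‖ ≤ Mφ * ‖w‖) (hφ' : ∀ X, ‖φ.symm X‖ ≤ Mφ' * ‖X‖) (hstar : ∀ X : 𝔸, ‖star X‖ ≤ ‖X‖)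
  {a : ℝ} (ha : 0 < a) {a' : ℝ} (ha' : 0 < a') {ϱ : ℝ} (hϱ0 : 0 ≤ ϱ) (hϱ1 : ϱ < 1)
  (τ : 𝔸 →ₗ[ℂ] ℂ) {Cτ : ℝ} (hτ : ∀ X, ‖τ X‖ ≤ Cτ * ‖X‖) (hCτ : 0 ≤ Cτ) {Mτ : ℝ} (hτm : ∀ X Y : 𝔸, ‖τ (X * Y)‖ ≤ Mτ * ‖X‖ * ‖Y‖) (hMτ : 0 ≤ Mτ)
  {ρw : ℝ} (hρw : 0 ≤ ρw)
  (hτ₁ : ∀ X : 𝔸, τ (star X) = conj (τ X)) (hτ₂ : ∀ X Y : 𝔸, τ (X * Y) = τ (Y * X)) (hφτ : ∀ X Y : 𝔸, ⟪φ.symm X, φ.symm Y⟫_ℂ = τ (star X * Y))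
  (AQ : ℝ)
  {ι : Type} [Fintype ι] [DecidableEq ι] (b : Module.Basis ι ℝ 𝔸) {M₂ : ℝ} (hM₂ : 0 ≤ M₂) (hrepr : ∀ (v : 𝔸) (i : ι), |b.repr v i| ≤ M₂ * ‖v‖)

include hd hL hL3 hMφ hMφ' hφ hφ' hstar ha ha' hϱ0 hϱ1 hτ hCτ hτm hMτ hρw hτ₁ hτ₂ hφτ hM₂ hrepr in
set_option maxHeartbeats 3200000 in
set_option maxRecDepth 8192 in
/-- **`B11Eq117FrakGkPiLetterDefectAtFlatOfOmegaHolder.exists_frakGkPi_letterDefect_at_flat_of_omegaHolder` WITH `Hω` DISCHARGED** (statement verbatim, now unconditional on the model). [folklore]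
[cite: Balaban1985Variational, Prop. 6 (116)–(121) p.295, (117) p.295, (174)–(175) p.305, Prop. 9 p.309; Balaban1985BackgroundPropagators, Thm 3.4 p.400, (3.122) p.420] -/
theorem exists_frakGkPi_letterDefect_at_flat [Fact (0 < (L : ℝ))] :
    ∃ α₁ j₁ K KD : ℝ, 0 < α₁ ∧ 0 < j₁ ∧ 0 ≤ K ∧ 0 ≤ KD ∧
      ∀ (n : ℕ) (η : ℝ) [Fact (0 < η)] (_hηL : η * (L : ℝ) ^ (n + 1) = 1) (c₀ c₁ : ℝ) [Fact (0 < c₀)] [Fact (0 < c₁)]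
        (_hw : c₀ * ((L : ℝ) ^ (n + 1)) ^ d = c₁) (_hρ : |η| ^ d / c₀ ≤ ρw) (m : Fin d → ℕ) [∀ i, NeZero (m i)] (_hm : ∀ i, 1 ≤ m i)
        (U : Bond d (towerP L m (n + 1)) → 𝔸ˣ) (αU : ℕ → ℝ) (_hα0 : ∀ j, 0 ≤ αU j) (hα1 : ∀ j, αU j ≤ 1 / 64)
        (_hαL : ∀ j, 50 * (d + 1) * αU j * (L : ℝ) ^ d ≤ 1 / 2)
        (hU1 : ∀ (j : ℕ) (x : B7Prop1Explicit.Site d) (k : Fin d), perCfg (towerP L m (j + 1)) (UlevOf L m (n + 1) U j) x k ∈ U1 𝔸)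
        (hreg : ∀ (j : ℕ) (y : TSite d (towerP L m j)) (k : Fin d) (ρ' : Fin d → Fin L),
          ‖((Wcx L (perCfg (towerP L m (j + 1)) (UlevOf L m (n + 1) U j)) (cornerSite L y) k (boxVec L ρ') : 𝔸ˣ) : 𝔸) - 1‖ ≤ αU j)
        (εU : ℕ → ℝ) (_hεU : ∀ j, 0 ≤ εU j) (_hε1 : ∀ j, εU j ≤ 1) (_hUε : ∀ (j : ℕ) (b : Bond d (towerP L m (j + 1))), ‖(UlevOf L m (n + 1) U j b : 𝔸) - 1‖ ≤ εU j)
        (_hLb : ∀ (j : ℕ) (b : Bond d (towerP L m (j + 1))), UlevOf L m (n + 1) U j b ∈ U1 𝔸)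
        (α : ℝ) (_hα : 0 ≤ α) (_hαle : α ≤ α₁)
        (hUst : ∀ b, star (U b : 𝔸) = (((U b)⁻¹ : 𝔸ˣ) : 𝔸)) (_hUb : ∀ b, U b ∈ U1 𝔸) (_hUη : ∀ b, ‖(U b : 𝔸) - 1‖ ≤ α * η)
        (_hUw : ∀ (x : TSite d (towerP L m (n + 1))) (μ ν : Fin d), ‖(U (shift ν x, μ) : 𝔸) - (U (x, μ) : 𝔸)‖ ≤ α * η ^ 2)
        (_hpl : ∀ p : B9SectCLatticeCarrier.Plaq d (towerP L m (n + 1)), ‖(plaqHolU U p : 𝔸) - 1‖ ≤ α * η ^ 2)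
        (_hUgrad : ∀ (x : TSite d (towerP L m (n + 1))) (μ : Fin d), ‖(U (x, μ) : 𝔸) - U (unshift μ x, μ)‖ ≤ α * η ^ 2)
        (_hRlev : ∀ (j : ℕ) (b : Bond d (towerP L m (j + 1))) (w : W), ‖adTransportW φ (UlevOf L m (n + 1) U j) b w‖ ≤ ‖w‖)
        (_hεg : ∀ j < n + 1, εU j ≤ α * ϱ ^ j) (_hAQ : ∑ j ∈ Finset.range (n + 1), αU j ≤ AQ)
        (hpos' : ∀ x : SiteL2K ℂ d (towerP L m (n + 1)) c₀ W, x ≠ 0 → 0 < RCLike.re ⟪x, laplacePrimeAk L m n φ η U a' (c₁ := c₁) x⟫_ℂ)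
        (hpos : ∀ x : BondL2K ℂ d (towerP L m (n + 1)) c₀ W, x ≠ 0 →
          0 < RCLike.re ⟪x, laplaceAk L m n φ η U hL αU hα1 hU1 hreg τ (c₀ := c₀) (c₁ := c₁) a x⟫_ℂ)
        (_hc₀η : c₀ = η ^ d) (j₀ : ℝ) (_hJ : ∀ μ y, ‖B9Eq39Adjoint.J (fun μ => B9Eq33CovDerivVector.shiftEquiv μ) (fun μ y => U (y, μ)) η μ y‖ ≤ j₀) (_hj : j₀ ≤ j₁)
        (hposπ : ∀ x : BondL2K ℂ d (towerP L m (n + 1)) c₀ W, x ≠ 0 →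
          0 < RCLike.re ⟪x, laplaceAkPi L m n φ τ η U a' hpos' hL αU hα1 hU1 hreg (c₁ := c₁) a x⟫_ℂ)
        (hQ : Function.Surjective (QkW L m n φ U hL αU hα1 hU1 hreg (c₀ := c₀) (c₁ := c₁)))
        (hpos'₁ : ∀ x : SiteL2K ℂ d (towerP L m (n + 1)) c₀ W, x ≠ 0 →
          0 < RCLike.re ⟪x, laplacePrimeAk L m n φ η (fun _ : Bond d (towerP L m (n + 1)) => (1 : 𝔸ˣ)) a' (c₁ := c₁) x⟫_ℂ)
        (hpos₁ : ∀ x : BondL2K ℂ d (towerP L m (n + 1)) c₀ W, x ≠ 0 →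
          0 < RCLike.re ⟪x, laplaceAk L m n φ η (fun _ : Bond d (towerP L m (n + 1)) => (1 : 𝔸ˣ)) hL (fun _ => 0) (fun _ => by norm_num)
            (perCfg_UlevOf_one_mem_U1 L m (n + 1)) (norm_Wcx_UlevOf_one_sub_one_le L m (n + 1) (fun _ => 0) (fun _ => le_rfl)) τ
            (c₀ := c₀) (c₁ := c₁) a x⟫_ℂ)
        (hQ1 : Function.Surjective (QkW L m n φ (fun _ : Bond d (towerP L m (n + 1)) => (1 : 𝔸ˣ)) hL (fun _ => 0) (fun _ => by norm_num)
          (perCfg_UlevOf_one_mem_U1 L m (n + 1)) (norm_Wcx_UlevOf_one_sub_one_le L m (n + 1) (fun _ => 0) (fun _ => le_rfl)) (c₀ := c₀) (c₁ := c₁)))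
        (lev₀ : Bond d (towerP L m (n + 1)) → ℕ) (lev₁ : Bond d (towerP L m (n + 1)) × Fin d → ℕ),
        ∀ f : NegSize (L : ℝ) η lev₀ 3 𝔸,
          ‖LinearMap.toContinuousLinearMap
              ((jetLinearEquiv (L : ℝ) η lev₀ lev₁ (nabla115 η (fun _ : Bond d (towerP L m (n + 1)) => (1 : 𝔸ˣ)))).symm.toLinearMap ∘ₗ
                (jetLinearEquiv (L : ℝ) η lev₀ lev₁ (nabla115 η U)).toLinearMap)
              (frakGLatticeCLM (L := (L : ℝ)) (η := η) (lev₀ := lev₀) φ hposπ hQ lev₁ (nabla115 η U) f) -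
            frakGLatticeCLM (L := (L : ℝ)) (η := η) (lev₀ := lev₀) (c := ((η : ℂ))⁻¹)
              (R := adTransportW φ (fun _ : Bond d (towerP L m (n + 1)) => (1 : 𝔸ˣ)))
              (S := adTransportW φ fun _ : Bond d (towerP L m (n + 1)) => (1 : 𝔸ˣ)⁻¹) (Δ₁ := hessOp φ η (fun _ : Bond d (towerP L m (n + 1)) => (1 : 𝔸ˣ)) τ)
              (Rr := RofUk L m n φ η (fun _ : Bond d (towerP L m (n + 1)) => (1 : 𝔸ˣ)))
              (Q := (QkW L m n φ (fun _ : Bond d (towerP L m (n + 1)) => (1 : 𝔸ˣ)) hL (fun _ => 0) (fun _ => by norm_num)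
                (perCfg_UlevOf_one_mem_U1 L m (n + 1)) (norm_Wcx_UlevOf_one_sub_one_le L m (n + 1) (fun _ => 0) (fun _ => le_rfl)) (c₀ := c₀) (c₁ := c₁))) (a := a)
              φ hpos₁ hQ1 lev₁ (nabla115 η (fun _ : Bond d (towerP L m (n + 1)) => (1 : 𝔸ˣ))) f‖ ≤
            max ((NegSup.wSup (levWeight (L : ℝ) η lev₀ 1) : ℝ) * (Mφ * ((j₀ + α) * K) * Mφ')) (NegSup.wSup (levWeight (L : ℝ) η lev₁ 2) * (Mφ * ((j₀ + α) * KD) * Mφ')) *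
              NegSup.wInvSup (levWeight (L : ℝ) η lev₀ 3) * ‖f‖ :=
  exists_frakGkPi_letterDefect_at_flat_of_omegaHolder hd L hL hL3 φ hMφ hMφ' hφ hφ' hstar ha ha' hϱ0 hϱ1 τ hτ hCτ hτm hMτ hρw hτ₁ hτ₂ hφτ AQ b hM₂ hrepr
    (exists_holderLetter_RkGpDstar_sub_flat hd L hL hL3 φ hMφ hMφ' hφ hφ' ha ha' hϱ0 hϱ1 τ hτ hCτ hMτ hρw hτ₁ hτ₂ hφτ AQ b hM₂ hrepr)

include hd hL hL3 hMφ hMφ' hφ hφ' hstar ha ha' hϱ0 hϱ1 hτ hCτ hτm hMτ hρw hτ₁ hτ₂ hφτ hM₂ hrepr in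
set_option maxHeartbeats 3200000 in
set_option maxRecDepth 8192 in
/-- **`B11Eq174ChartLipschitzAtFlatLatticeFreeOfOmegaHolder.exists_chart_arg_lipschitz_at_flat_latticeFree_of_omegaHolder` WITH `Hω` DISCHARGED** (statement verbatim, now unconditional on the model). [folklore]
[cite: Balaban1985Variational, Prop. 6 (116)–(121) p.295, (117) p.295, (174)–(175) p.305, Prop. 9 p.309; Balaban1985BackgroundPropagators, Thm 3.4 p.400, (3.122) p.420] -/
theorem exists_chart_arg_lipschitz_at_flat_latticeFree [Fact (0 < (L : ℝ))] :
    ∃ α₁ j₁ KA KG KD : ℝ, 0 < α₁ ∧ 0 < j₁ ∧ 0 ≤ KA ∧ 0 ≤ KG ∧ 0 ≤ KD ∧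
      ∀ (n : ℕ) (η : ℝ) [Fact (0 < η)] (_hηL : η * (L : ℝ) ^ (n + 1) = 1) (c₀ c₁ : ℝ) [Fact (0 < c₀)] [Fact (0 < c₁)]
        (_hw : c₀ * ((L : ℝ) ^ (n + 1)) ^ d = c₁) (_hρ : |η| ^ d / c₀ ≤ ρw) (m : Fin d → ℕ) [∀ i, NeZero (m i)] (_hm : ∀ i, 1 ≤ m i)
        (U : Bond d (towerP L m (n + 1)) → 𝔸ˣ) (αU : ℕ → ℝ) (_hα0 : ∀ j, 0 ≤ αU j) (hα1 : ∀ j, αU j ≤ 1 / 64)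
        (_hαL : ∀ j, 50 * (d + 1) * αU j * (L : ℝ) ^ d ≤ 1 / 2)
        (hU1 : ∀ (j : ℕ) (x : B7Prop1Explicit.Site d) (k : Fin d), perCfg (towerP L m (j + 1)) (UlevOf L m (n + 1) U j) x k ∈ U1 𝔸)
        (hreg : ∀ (j : ℕ) (y : TSite d (towerP L m j)) (k : Fin d) (ρ' : Fin d → Fin L),
          ‖((Wcx L (perCfg (towerP L m (j + 1)) (UlevOf L m (n + 1) U j)) (cornerSite L y) k (boxVec L ρ') : 𝔸ˣ) : 𝔸) - 1‖ ≤ αU j)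
        (εU : ℕ → ℝ) (_hεU : ∀ j, 0 ≤ εU j) (_hε1 : ∀ j, εU j ≤ 1) (_hUε : ∀ (j : ℕ) (b : Bond d (towerP L m (j + 1))), ‖(UlevOf L m (n + 1) U j b : 𝔸) - 1‖ ≤ εU j)
        (_hLb : ∀ (j : ℕ) (b : Bond d (towerP L m (j + 1))), UlevOf L m (n + 1) U j b ∈ U1 𝔸)
        (α : ℝ) (_hα : 0 ≤ α) (_hαle : α ≤ α₁)
        (hUst : ∀ b, star (U b : 𝔸) = (((U b)⁻¹ : 𝔸ˣ) : 𝔸)) (_hUb : ∀ b, U b ∈ U1 𝔸) (_hUη : ∀ b, ‖(U b : 𝔸) - 1‖ ≤ α * η)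
        (_hUw : ∀ (x : TSite d (towerP L m (n + 1))) (μ ν : Fin d), ‖(U (shift ν x, μ) : 𝔸) - (U (x, μ) : 𝔸)‖ ≤ α * η ^ 2)
        (_hpl : ∀ p : B9SectCLatticeCarrier.Plaq d (towerP L m (n + 1)), ‖(plaqHolU U p : 𝔸) - 1‖ ≤ α * η ^ 2)
        (_hUgrad : ∀ (x : TSite d (towerP L m (n + 1))) (μ : Fin d), ‖(U (x, μ) : 𝔸) - U (unshift μ x, μ)‖ ≤ α * η ^ 2)
        (_hRlev : ∀ (j : ℕ) (b : Bond d (towerP L m (j + 1))) (w : W), ‖adTransportW φ (UlevOf L m (n + 1) U j) b w‖ ≤ ‖w‖)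
        (_hεg : ∀ j < n + 1, εU j ≤ α * ϱ ^ j) (_hAQ : ∑ j ∈ Finset.range (n + 1), αU j ≤ AQ)
        (hpos' : ∀ x : SiteL2K ℂ d (towerP L m (n + 1)) c₀ W, x ≠ 0 → 0 < RCLike.re ⟪x, laplacePrimeAk L m n φ η U a' (c₁ := c₁) x⟫_ℂ)
        (hpos : ∀ x : BondL2K ℂ d (towerP L m (n + 1)) c₀ W, x ≠ 0 →
          0 < RCLike.re ⟪x, laplaceAk L m n φ η U hL αU hα1 hU1 hreg τ (c₀ := c₀) (c₁ := c₁) a x⟫_ℂ)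
        (_hc₀η : c₀ = η ^ d) (j₀ : ℝ) (_hJ : ∀ μ y, ‖B9Eq39Adjoint.J (fun μ => B9Eq33CovDerivVector.shiftEquiv μ) (fun μ y => U (y, μ)) η μ y‖ ≤ j₀) (_hj : j₀ ≤ j₁)
        (hposπ : ∀ x : BondL2K ℂ d (towerP L m (n + 1)) c₀ W, x ≠ 0 →
          0 < RCLike.re ⟪x, laplaceAkPi L m n φ τ η U a' hpos' hL αU hα1 hU1 hreg (c₁ := c₁) a x⟫_ℂ)
        (hQ : Function.Surjective (QkW L m n φ U hL αU hα1 hU1 hreg (c₀ := c₀) (c₁ := c₁)))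
        (hpos'₁ : ∀ x : SiteL2K ℂ d (towerP L m (n + 1)) c₀ W, x ≠ 0 →
          0 < RCLike.re ⟪x, laplacePrimeAk L m n φ η (fun _ : Bond d (towerP L m (n + 1)) => (1 : 𝔸ˣ)) a' (c₁ := c₁) x⟫_ℂ)
        (hpos₁ : ∀ x : BondL2K ℂ d (towerP L m (n + 1)) c₀ W, x ≠ 0 →
          0 < RCLike.re ⟪x, laplaceAk L m n φ η (fun _ : Bond d (towerP L m (n + 1)) => (1 : 𝔸ˣ)) hL (fun _ => 0) (fun _ => by norm_num)
            (perCfg_UlevOf_one_mem_U1 L m (n + 1)) (norm_Wcx_UlevOf_one_sub_one_le L m (n + 1) (fun _ => 0) (fun _ => le_rfl)) τ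
            (c₀ := c₀) (c₁ := c₁) a x⟫_ℂ)
        (hQ1 : Function.Surjective (QkW L m n φ (fun _ : Bond d (towerP L m (n + 1)) => (1 : 𝔸ˣ)) hL (fun _ => 0) (fun _ => by norm_num)
          (perCfg_UlevOf_one_mem_U1 L m (n + 1)) (norm_Wcx_UlevOf_one_sub_one_le L m (n + 1) (fun _ => 0) (fun _ => le_rfl)) (c₀ := c₀) (c₁ := c₁)))
        (lev₀ : Bond d (towerP L m (n + 1)) → ℕ) (levB : Bond d m → ℕ) (lev₁ : Bond d (towerP L m (n + 1)) × Fin d → ℕ)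
        {W₁ : Space115 (L : ℝ) η lev₀ lev₁ (nabla115 η U) → NegSize (L : ℝ) η lev₀ 3 𝔸}
        {W₂ : Space115 (L : ℝ) η lev₀ lev₁ (nabla115 η (fun _ : Bond d (towerP L m (n + 1)) => (1 : 𝔸ˣ))) → NegSize (L : ℝ) η lev₀ 3 𝔸}
        {B₀ θ C₄ a₃ jr ar ε₄ B₀' θ' C₄' a₃' jr' ar' ε₄' δW ρ s : ℝ}
        (_R₁ : Regime (frakGLatticeCLM (L := (L : ℝ)) (η := η) (lev₀ := lev₀) φ hposπ hQ lev₁ (nabla115 η U)) 0 W₁ B₀ θ C₄ a₃ jr ar ε₄)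
        (_R₂ : Regime (frakGLatticeCLM (L := (L : ℝ)) (η := η) (lev₀ := lev₀) (c := ((η : ℂ))⁻¹)
              (R := adTransportW φ (fun _ : Bond d (towerP L m (n + 1)) => (1 : 𝔸ˣ)))
              (S := adTransportW φ fun _ : Bond d (towerP L m (n + 1)) => (1 : 𝔸ˣ)⁻¹) (Δ₁ := hessOp φ η (fun _ : Bond d (towerP L m (n + 1)) => (1 : 𝔸ˣ)) τ)
              (Rr := RofUk L m n φ η (fun _ : Bond d (towerP L m (n + 1)) => (1 : 𝔸ˣ)))
              (Q := (QkW L m n φ (fun _ : Bond d (towerP L m (n + 1)) => (1 : 𝔸ˣ)) hL (fun _ => 0) (fun _ => by norm_num)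
                (perCfg_UlevOf_one_mem_U1 L m (n + 1)) (norm_Wcx_UlevOf_one_sub_one_le L m (n + 1) (fun _ => 0) (fun _ => le_rfl)) (c₀ := c₀) (c₁ := c₁))) (a := a)
              φ hpos₁ hQ1 lev₁ (nabla115 η (fun _ : Bond d (towerP L m (n + 1)) => (1 : 𝔸ˣ)))) 0 W₂ B₀' θ' C₄' a₃' jr' ar' ε₄')
        (_hj : 0 ≤ jr) (_hj' : 0 ≤ jr') (B : NegSize (L : ℝ) η levB 0 𝔸)
        (_hB : ‖H1LatticeCLM (L := (L : ℝ)) (η := η) (lev₀ := lev₀) (levB := levB) φ hposπ hQ lev₁ (nabla115 η U) B‖ < ar)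
        (_hB' : ‖H1LatticeCLM (L := (L : ℝ)) (η := η) (lev₀ := lev₀) (levB := levB) (c := ((η : ℂ))⁻¹)
              (R := adTransportW φ (fun _ : Bond d (towerP L m (n + 1)) => (1 : 𝔸ˣ)))
              (S := adTransportW φ fun _ : Bond d (towerP L m (n + 1)) => (1 : 𝔸ˣ)⁻¹) (Δ₁ := hessOp φ η (fun _ : Bond d (towerP L m (n + 1)) => (1 : 𝔸ˣ)) τ)
              (Rr := RofUk L m n φ η (fun _ : Bond d (towerP L m (n + 1)) => (1 : 𝔸ˣ)))
              (Q := (QkW L m n φ (fun _ : Bond d (towerP L m (n + 1)) => (1 : 𝔸ˣ)) hL (fun _ => 0) (fun _ => by norm_num)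
                (perCfg_UlevOf_one_mem_U1 L m (n + 1)) (norm_Wcx_UlevOf_one_sub_one_le L m (n + 1) (fun _ => 0) (fun _ => le_rfl)) (c₀ := c₀) (c₁ := c₁))) (a := a)
              φ hpos₁ hQ1 lev₁ (nabla115 η (fun _ : Bond d (towerP L m (n + 1)) => (1 : 𝔸ˣ))) B‖ < ar')
        (_hδW : ∀ P : Space115 (L : ℝ) η lev₀ lev₁ (nabla115 η U), ‖P‖ < ε₄ + ar →
          ‖W₁ P - W₂ (LinearMap.toContinuousLinearMap
            ((jetLinearEquiv (L : ℝ) η lev₀ lev₁ (nabla115 η (fun _ : Bond d (towerP L m (n + 1)) => (1 : 𝔸ˣ)))).symm.toLinearMap ∘ₗ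
              (jetLinearEquiv (L : ℝ) η lev₀ lev₁ (nabla115 η U)).toLinearMap) P)‖ ≤ δW)
        (_hρ₁ : (1 + (NegSup.wSup (levWeight (L : ℝ) η lev₁ 2) : ℝ) * (2 * α) * NegSup.wInvSup (levWeight (L : ℝ) η lev₀ 1)) * (ε₄ + ar) ≤ ρ)
        (_hρ₂ : ε₄' + ar' ≤ ρ) (_hs : 0 < s) (_hdom : 2 * (ρ + s) ≤ a₃') (_hκ : θ' + 4 * B₀' * C₄' * (ρ + s) < 1),
        ‖LinearMap.toContinuousLinearMap
              ((jetLinearEquiv (L : ℝ) η lev₀ lev₁ (nabla115 η (fun _ : Bond d (towerP L m (n + 1)) => (1 : 𝔸ˣ)))).symm.toLinearMap ∘ₗ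
                (jetLinearEquiv (L : ℝ) η lev₀ lev₁ (nabla115 η U)).toLinearMap)
            (solA (frakGLatticeCLM (L := (L : ℝ)) (η := η) (lev₀ := lev₀) φ hposπ hQ lev₁ (nabla115 η U)) 0 W₁ 0 ε₄
                (H1LatticeCLM (L := (L : ℝ)) (η := η) (lev₀ := lev₀) (levB := levB) φ hposπ hQ lev₁ (nabla115 η U) B) +
              H1LatticeCLM (L := (L : ℝ)) (η := η) (lev₀ := lev₀) (levB := levB) φ hposπ hQ lev₁ (nabla115 η U) B) -
          (solA (frakGLatticeCLM (L := (L : ℝ)) (η := η) (lev₀ := lev₀) (c := ((η : ℂ))⁻¹)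
              (R := adTransportW φ (fun _ : Bond d (towerP L m (n + 1)) => (1 : 𝔸ˣ)))
              (S := adTransportW φ fun _ : Bond d (towerP L m (n + 1)) => (1 : 𝔸ˣ)⁻¹) (Δ₁ := hessOp φ η (fun _ : Bond d (towerP L m (n + 1)) => (1 : 𝔸ˣ)) τ)
              (Rr := RofUk L m n φ η (fun _ : Bond d (towerP L m (n + 1)) => (1 : 𝔸ˣ)))
              (Q := (QkW L m n φ (fun _ : Bond d (towerP L m (n + 1)) => (1 : 𝔸ˣ)) hL (fun _ => 0) (fun _ => by norm_num)
                (perCfg_UlevOf_one_mem_U1 L m (n + 1)) (norm_Wcx_UlevOf_one_sub_one_le L m (n + 1) (fun _ => 0) (fun _ => le_rfl)) (c₀ := c₀) (c₁ := c₁))) (a := a)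
              φ hpos₁ hQ1 lev₁ (nabla115 η (fun _ : Bond d (towerP L m (n + 1)) => (1 : 𝔸ˣ)))) 0 W₂ 0 ε₄'
              (H1LatticeCLM (L := (L : ℝ)) (η := η) (lev₀ := lev₀) (levB := levB) (c := ((η : ℂ))⁻¹)
              (R := adTransportW φ (fun _ : Bond d (towerP L m (n + 1)) => (1 : 𝔸ˣ)))
              (S := adTransportW φ fun _ : Bond d (towerP L m (n + 1)) => (1 : 𝔸ˣ)⁻¹) (Δ₁ := hessOp φ η (fun _ : Bond d (towerP L m (n + 1)) => (1 : 𝔸ˣ)) τ)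
              (Rr := RofUk L m n φ η (fun _ : Bond d (towerP L m (n + 1)) => (1 : 𝔸ˣ)))
              (Q := (QkW L m n φ (fun _ : Bond d (towerP L m (n + 1)) => (1 : 𝔸ˣ)) hL (fun _ => 0) (fun _ => by norm_num)
                (perCfg_UlevOf_one_mem_U1 L m (n + 1)) (norm_Wcx_UlevOf_one_sub_one_le L m (n + 1) (fun _ => 0) (fun _ => le_rfl)) (c₀ := c₀) (c₁ := c₁))) (a := a)
              φ hpos₁ hQ1 lev₁ (nabla115 η (fun _ : Bond d (towerP L m (n + 1)) => (1 : 𝔸ˣ))) B) +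
            H1LatticeCLM (L := (L : ℝ)) (η := η) (lev₀ := lev₀) (levB := levB) (c := ((η : ℂ))⁻¹)
              (R := adTransportW φ (fun _ : Bond d (towerP L m (n + 1)) => (1 : 𝔸ˣ)))
              (S := adTransportW φ fun _ : Bond d (towerP L m (n + 1)) => (1 : 𝔸ˣ)⁻¹) (Δ₁ := hessOp φ η (fun _ : Bond d (towerP L m (n + 1)) => (1 : 𝔸ˣ)) τ)
              (Rr := RofUk L m n φ η (fun _ : Bond d (towerP L m (n + 1)) => (1 : 𝔸ˣ)))
              (Q := (QkW L m n φ (fun _ : Bond d (towerP L m (n + 1)) => (1 : 𝔸ˣ)) hL (fun _ => 0) (fun _ => by norm_num)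
                (perCfg_UlevOf_one_mem_U1 L m (n + 1)) (norm_Wcx_UlevOf_one_sub_one_le L m (n + 1) (fun _ => 0) (fun _ => le_rfl)) (c₀ := c₀) (c₁ := c₁))) (a := a)
              φ hpos₁ hQ1 lev₁ (nabla115 η (fun _ : Bond d (towerP L m (n + 1)) => (1 : 𝔸ˣ))) B)‖ ≤
          ((max ((NegSup.wSup (levWeight (L : ℝ) η lev₀ 1) : ℝ) * (Mφ * ((j₀ + α) * KG) * Mφ')) (NegSup.wSup (levWeight (L : ℝ) η lev₁ 2) * (Mφ * ((j₀ + α) * KD) * Mφ')) *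
              NegSup.wInvSup (levWeight (L : ℝ) η lev₀ 3)) * (jr + C₄ * (ε₄ + ar) ^ 2) + B₀' * δW +
            (max ((NegSup.wSup (levWeight (L : ℝ) η lev₀ 1) : ℝ) * (Mφ * ((j₀ + α) * KA) * Mφ')) (NegSup.wSup (levWeight (L : ℝ) η lev₁ 2) * (Mφ * ((j₀ + α) * KA) * Mφ')) *
              NegSup.wInvSup (levWeight (L : ℝ) η levB 0)) * ‖B‖) / (1 - (θ' + 4 * B₀' * C₄' * (ρ + s))) :=
  exists_chart_arg_lipschitz_at_flat_latticeFree_of_omegaHolder hd L hL hL3 φ hMφ hMφ' hφ hφ' hstar ha ha' hϱ0 hϱ1 τ hτ hCτ hτm hMτ hρw hτ₁ hτ₂ hφτ AQ b hM₂ hrepr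
    (exists_holderLetter_RkGpDstar_sub_flat hd L hL hL3 φ hMφ hMφ' hφ hφ' ha ha' hϱ0 hϱ1 τ hτ hCτ hMτ hρw hτ₁ hτ₂ hφτ AQ b hM₂ hrepr)

include hd hL hL3 hMφ hMφ' hφ hφ' hstar ha ha' hϱ0 hϱ1 hτ hCτ hτm hMτ hρw hτ₁ hτ₂ hφτ hM₂ hrepr in
set_option maxHeartbeats 3200000 in
set_option maxRecDepth 8192 in
/-- **`B11Eq174ChartLipschitzAtFlatLatticeFreeOfOmegaHolder.exists_chartHB_lipschitz_at_flat_latticeFree_of_omegaHolder` WITH `Hω` DISCHARGED** (statement verbatim, now unconditional on the model). [folklore]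
[cite: Balaban1985Variational, Prop. 6 (116)–(121) p.295, (117) p.295, (174)–(175) p.305, (47) p.284, Prop. 9 p.309; Balaban1985BackgroundPropagators, Thm 3.4 p.400, (3.122) p.420] -/
theorem exists_chartHB_lipschitz_at_flat_latticeFree [Fact (0 < (L : ℝ))] :
    ∃ α₁ j₁ KA KG KD : ℝ, 0 < α₁ ∧ 0 < j₁ ∧ 0 ≤ KA ∧ 0 ≤ KG ∧ 0 ≤ KD ∧
      ∀ (n : ℕ) (η : ℝ) [Fact (0 < η)] (_hηL : η * (L : ℝ) ^ (n + 1) = 1) (c₀ c₁ : ℝ) [Fact (0 < c₀)] [Fact (0 < c₁)]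
        (_hw : c₀ * ((L : ℝ) ^ (n + 1)) ^ d = c₁) (_hρ : |η| ^ d / c₀ ≤ ρw) (m : Fin d → ℕ) [∀ i, NeZero (m i)] (_hm : ∀ i, 1 ≤ m i)
        (U : Bond d (towerP L m (n + 1)) → 𝔸ˣ) (αU : ℕ → ℝ) (_hα0 : ∀ j, 0 ≤ αU j) (hα1 : ∀ j, αU j ≤ 1 / 64)
        (_hαL : ∀ j, 50 * (d + 1) * αU j * (L : ℝ) ^ d ≤ 1 / 2)
        (hU1 : ∀ (j : ℕ) (x : B7Prop1Explicit.Site d) (k : Fin d), perCfg (towerP L m (j + 1)) (UlevOf L m (n + 1) U j) x k ∈ U1 𝔸)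
        (hreg : ∀ (j : ℕ) (y : TSite d (towerP L m j)) (k : Fin d) (ρ' : Fin d → Fin L),
          ‖((Wcx L (perCfg (towerP L m (j + 1)) (UlevOf L m (n + 1) U j)) (cornerSite L y) k (boxVec L ρ') : 𝔸ˣ) : 𝔸) - 1‖ ≤ αU j)
        (εU : ℕ → ℝ) (_hεU : ∀ j, 0 ≤ εU j) (_hε1 : ∀ j, εU j ≤ 1) (_hUε : ∀ (j : ℕ) (b : Bond d (towerP L m (j + 1))), ‖(UlevOf L m (n + 1) U j b : 𝔸) - 1‖ ≤ εU j)
        (_hLb : ∀ (j : ℕ) (b : Bond d (towerP L m (j + 1))), UlevOf L m (n + 1) U j b ∈ U1 𝔸)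
        (α : ℝ) (_hα : 0 ≤ α) (_hαle : α ≤ α₁)
        (hUst : ∀ b, star (U b : 𝔸) = (((U b)⁻¹ : 𝔸ˣ) : 𝔸)) (_hUb : ∀ b, U b ∈ U1 𝔸) (_hUη : ∀ b, ‖(U b : 𝔸) - 1‖ ≤ α * η)
        (_hUw : ∀ (x : TSite d (towerP L m (n + 1))) (μ ν : Fin d), ‖(U (shift ν x, μ) : 𝔸) - (U (x, μ) : 𝔸)‖ ≤ α * η ^ 2)
        (_hpl : ∀ p : B9SectCLatticeCarrier.Plaq d (towerP L m (n + 1)), ‖(plaqHolU U p : 𝔸) - 1‖ ≤ α * η ^ 2)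
        (_hUgrad : ∀ (x : TSite d (towerP L m (n + 1))) (μ : Fin d), ‖(U (x, μ) : 𝔸) - U (unshift μ x, μ)‖ ≤ α * η ^ 2)
        (_hRlev : ∀ (j : ℕ) (b : Bond d (towerP L m (j + 1))) (w : W), ‖adTransportW φ (UlevOf L m (n + 1) U j) b w‖ ≤ ‖w‖)
        (_hεg : ∀ j < n + 1, εU j ≤ α * ϱ ^ j) (_hAQ : ∑ j ∈ Finset.range (n + 1), αU j ≤ AQ)
        (hpos' : ∀ x : SiteL2K ℂ d (towerP L m (n + 1)) c₀ W, x ≠ 0 → 0 < RCLike.re ⟪x, laplacePrimeAk L m n φ η U a' (c₁ := c₁) x⟫_ℂ)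
        (hpos : ∀ x : BondL2K ℂ d (towerP L m (n + 1)) c₀ W, x ≠ 0 →
          0 < RCLike.re ⟪x, laplaceAk L m n φ η U hL αU hα1 hU1 hreg τ (c₀ := c₀) (c₁ := c₁) a x⟫_ℂ)
        (_hc₀η : c₀ = η ^ d) (j₀ : ℝ) (_hJ : ∀ μ y, ‖B9Eq39Adjoint.J (fun μ => B9Eq33CovDerivVector.shiftEquiv μ) (fun μ y => U (y, μ)) η μ y‖ ≤ j₀) (_hj : j₀ ≤ j₁)
        (hposπ : ∀ x : BondL2K ℂ d (towerP L m (n + 1)) c₀ W, x ≠ 0 →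
          0 < RCLike.re ⟪x, laplaceAkPi L m n φ τ η U a' hpos' hL αU hα1 hU1 hreg (c₁ := c₁) a x⟫_ℂ)
        (hQ : Function.Surjective (QkW L m n φ U hL αU hα1 hU1 hreg (c₀ := c₀) (c₁ := c₁)))
        (hpos'₁ : ∀ x : SiteL2K ℂ d (towerP L m (n + 1)) c₀ W, x ≠ 0 →
          0 < RCLike.re ⟪x, laplacePrimeAk L m n φ η (fun _ : Bond d (towerP L m (n + 1)) => (1 : 𝔸ˣ)) a' (c₁ := c₁) x⟫_ℂ)
        (hpos₁ : ∀ x : BondL2K ℂ d (towerP L m (n + 1)) c₀ W, x ≠ 0 →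
          0 < RCLike.re ⟪x, laplaceAk L m n φ η (fun _ : Bond d (towerP L m (n + 1)) => (1 : 𝔸ˣ)) hL (fun _ => 0) (fun _ => by norm_num)
            (perCfg_UlevOf_one_mem_U1 L m (n + 1)) (norm_Wcx_UlevOf_one_sub_one_le L m (n + 1) (fun _ => 0) (fun _ => le_rfl)) τ
            (c₀ := c₀) (c₁ := c₁) a x⟫_ℂ)
        (hQ1 : Function.Surjective (QkW L m n φ (fun _ : Bond d (towerP L m (n + 1)) => (1 : 𝔸ˣ)) hL (fun _ => 0) (fun _ => by norm_num)
          (perCfg_UlevOf_one_mem_U1 L m (n + 1)) (norm_Wcx_UlevOf_one_sub_one_le L m (n + 1) (fun _ => 0) (fun _ => le_rfl)) (c₀ := c₀) (c₁ := c₁)))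
        (lev₀ : Bond d (towerP L m (n + 1)) → ℕ) (levB : Bond d m → ℕ) (lev₁ : Bond d (towerP L m (n + 1)) × Fin d → ℕ)
        {W₁ : Space115 (L : ℝ) η lev₀ lev₁ (nabla115 η U) → NegSize (L : ℝ) η lev₀ 3 𝔸}
        {W₂ : Space115 (L : ℝ) η lev₀ lev₁ (nabla115 η (fun _ : Bond d (towerP L m (n + 1)) => (1 : 𝔸ˣ))) → NegSize (L : ℝ) η lev₀ 3 𝔸}
        {B₀ θ C₄ a₃ jr ar ε₄ B₀' θ' C₄' a₃' jr' ar' ε₄' δW ρ s : ℝ}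
        (_R₁ : Regime (frakGLatticeCLM (L := (L : ℝ)) (η := η) (lev₀ := lev₀) φ hposπ hQ lev₁ (nabla115 η U)) 0 W₁ B₀ θ C₄ a₃ jr ar ε₄)
        (_R₂ : Regime (frakGLatticeCLM (L := (L : ℝ)) (η := η) (lev₀ := lev₀) (c := ((η : ℂ))⁻¹)
              (R := adTransportW φ (fun _ : Bond d (towerP L m (n + 1)) => (1 : 𝔸ˣ)))
              (S := adTransportW φ fun _ : Bond d (towerP L m (n + 1)) => (1 : 𝔸ˣ)⁻¹) (Δ₁ := hessOp φ η (fun _ : Bond d (towerP L m (n + 1)) => (1 : 𝔸ˣ)) τ)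
              (Rr := RofUk L m n φ η (fun _ : Bond d (towerP L m (n + 1)) => (1 : 𝔸ˣ)))
              (Q := (QkW L m n φ (fun _ : Bond d (towerP L m (n + 1)) => (1 : 𝔸ˣ)) hL (fun _ => 0) (fun _ => by norm_num)
                (perCfg_UlevOf_one_mem_U1 L m (n + 1)) (norm_Wcx_UlevOf_one_sub_one_le L m (n + 1) (fun _ => 0) (fun _ => le_rfl)) (c₀ := c₀) (c₁ := c₁))) (a := a)
              φ hpos₁ hQ1 lev₁ (nabla115 η (fun _ : Bond d (towerP L m (n + 1)) => (1 : 𝔸ˣ)))) 0 W₂ B₀' θ' C₄' a₃' jr' ar' ε₄')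
        (_hj : 0 ≤ jr) (_hj' : 0 ≤ jr') (B : NegSize (L : ℝ) η levB 0 𝔸)
        (_hB : ‖H1LatticeCLM (L := (L : ℝ)) (η := η) (lev₀ := lev₀) (levB := levB) φ hposπ hQ lev₁ (nabla115 η U) B‖ < ar)
        (_hB' : ‖H1LatticeCLM (L := (L : ℝ)) (η := η) (lev₀ := lev₀) (levB := levB) (c := ((η : ℂ))⁻¹)
              (R := adTransportW φ (fun _ : Bond d (towerP L m (n + 1)) => (1 : 𝔸ˣ)))
              (S := adTransportW φ fun _ : Bond d (towerP L m (n + 1)) => (1 : 𝔸ˣ)⁻¹) (Δ₁ := hessOp φ η (fun _ : Bond d (towerP L m (n + 1)) => (1 : 𝔸ˣ)) τ)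
              (Rr := RofUk L m n φ η (fun _ : Bond d (towerP L m (n + 1)) => (1 : 𝔸ˣ)))
              (Q := (QkW L m n φ (fun _ : Bond d (towerP L m (n + 1)) => (1 : 𝔸ˣ)) hL (fun _ => 0) (fun _ => by norm_num)
                (perCfg_UlevOf_one_mem_U1 L m (n + 1)) (norm_Wcx_UlevOf_one_sub_one_le L m (n + 1) (fun _ => 0) (fun _ => le_rfl)) (c₀ := c₀) (c₁ := c₁))) (a := a)
              φ hpos₁ hQ1 lev₁ (nabla115 η (fun _ : Bond d (towerP L m (n + 1)) => (1 : 𝔸ˣ))) B‖ < ar')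
        (_hδW : ∀ P : Space115 (L : ℝ) η lev₀ lev₁ (nabla115 η U), ‖P‖ < ε₄ + ar →
          ‖W₁ P - W₂ (LinearMap.toContinuousLinearMap
            ((jetLinearEquiv (L : ℝ) η lev₀ lev₁ (nabla115 η (fun _ : Bond d (towerP L m (n + 1)) => (1 : 𝔸ˣ)))).symm.toLinearMap ∘ₗ
              (jetLinearEquiv (L : ℝ) η lev₀ lev₁ (nabla115 η U)).toLinearMap) P)‖ ≤ δW)
        (_hρ₁ : (1 + (NegSup.wSup (levWeight (L : ℝ) η lev₁ 2) : ℝ) * (2 * α) * NegSup.wInvSup (levWeight (L : ℝ) η lev₀ 1)) * (ε₄ + ar) ≤ ρ)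
        (_hρ₂ : ε₄' + ar' ≤ ρ) (_hs : 0 < s) (_hdom : 2 * (ρ + s) ≤ a₃') (_hκ : θ' + 4 * B₀' * C₄' * (ρ + s) < 1)
        {bC C₂c c₄ aC εC bC' C₂c' c₄' aC' εC' δC ρC sC : ℝ}
        (_RC₁ : Regime (H1LatticeCLM (L := (L : ℝ)) (η := η) (lev₀ := lev₀) (levB := levB) φ hposπ hQ lev₁ (nabla115 η U)) 0
          (Cck L m η (n + 1) U lev₀ lev₁ (nabla115 η U) levB) bC 0 C₂c c₄ 0 aC εC)
        (_RC₂ : Regime (H1LatticeCLM (L := (L : ℝ)) (η := η) (lev₀ := lev₀) (levB := levB) (c := ((η : ℂ))⁻¹)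
              (R := adTransportW φ (fun _ : Bond d (towerP L m (n + 1)) => (1 : 𝔸ˣ)))
              (S := adTransportW φ fun _ : Bond d (towerP L m (n + 1)) => (1 : 𝔸ˣ)⁻¹) (Δ₁ := hessOp φ η (fun _ : Bond d (towerP L m (n + 1)) => (1 : 𝔸ˣ)) τ)
              (Rr := RofUk L m n φ η (fun _ : Bond d (towerP L m (n + 1)) => (1 : 𝔸ˣ)))
              (Q := (QkW L m n φ (fun _ : Bond d (towerP L m (n + 1)) => (1 : 𝔸ˣ)) hL (fun _ => 0) (fun _ => by norm_num)
                (perCfg_UlevOf_one_mem_U1 L m (n + 1)) (norm_Wcx_UlevOf_one_sub_one_le L m (n + 1) (fun _ => 0) (fun _ => le_rfl)) (c₀ := c₀) (c₁ := c₁))) (a := a)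
              φ hpos₁ hQ1 lev₁ (nabla115 η (fun _ : Bond d (towerP L m (n + 1)) => (1 : 𝔸ˣ)))) 0
          (Cck L m η (n + 1) (fun _ : Bond d (towerP L m (n + 1)) => (1 : 𝔸ˣ)) lev₀ lev₁ (nabla115 η (fun _ : Bond d (towerP L m (n + 1)) => (1 : 𝔸ˣ))) levB)
          bC' 0 C₂c' c₄' 0 aC' εC')
        (_hcap : ε₄ + ar ≤ aC) (_hcap' : ε₄' + ar' ≤ aC')
        (_hδC : ∀ P : Space115 (L : ℝ) η lev₀ lev₁ (nabla115 η U), ‖P‖ < εC + aC →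
          ‖Cck L m η (n + 1) U lev₀ lev₁ (nabla115 η U) levB P -
            Cck L m η (n + 1) (fun _ : Bond d (towerP L m (n + 1)) => (1 : 𝔸ˣ)) lev₀ lev₁ (nabla115 η (fun _ : Bond d (towerP L m (n + 1)) => (1 : 𝔸ˣ))) levB
              (LinearMap.toContinuousLinearMap
                ((jetLinearEquiv (L : ℝ) η lev₀ lev₁ (nabla115 η (fun _ : Bond d (towerP L m (n + 1)) => (1 : 𝔸ˣ)))).symm.toLinearMap ∘ₗ
                  (jetLinearEquiv (L : ℝ) η lev₀ lev₁ (nabla115 η U)).toLinearMap) P)‖ ≤ δC)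
        (_hρC₁ : (1 + (NegSup.wSup (levWeight (L : ℝ) η lev₁ 2) : ℝ) * (2 * α) * NegSup.wInvSup (levWeight (L : ℝ) η lev₀ 1)) * (εC + aC) ≤ ρC)
        (_hρC₂ : εC' + aC' ≤ ρC) (_hsC : 0 < sC) (_hdomC : 2 * (ρC + sC) ≤ c₄') (_hκC : 4 * bC' * C₂c' * (ρC + sC) < 1),
        ‖LinearMap.toContinuousLinearMap
              ((jetLinearEquiv (L : ℝ) η lev₀ lev₁ (nabla115 η (fun _ : Bond d (towerP L m (n + 1)) => (1 : 𝔸ˣ)))).symm.toLinearMap ∘ₗ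
                (jetLinearEquiv (L : ℝ) η lev₀ lev₁ (nabla115 η U)).toLinearMap)
            (chartHB (frakGLatticeCLM (L := (L : ℝ)) (η := η) (lev₀ := lev₀) φ hposπ hQ lev₁ (nabla115 η U)) 0 W₁ 0
              (fun A' => A' + solA (H1LatticeCLM (L := (L : ℝ)) (η := η) (lev₀ := lev₀) (levB := levB) φ hposπ hQ lev₁ (nabla115 η U)) 0
                (Cck L m η (n + 1) U lev₀ lev₁ (nabla115 η U) levB) 0 εC A') ε₄
              (H1LatticeCLM (L := (L : ℝ)) (η := η) (lev₀ := lev₀) (levB := levB) φ hposπ hQ lev₁ (nabla115 η U)) B) -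
          chartHB (frakGLatticeCLM (L := (L : ℝ)) (η := η) (lev₀ := lev₀) (c := ((η : ℂ))⁻¹)
              (R := adTransportW φ (fun _ : Bond d (towerP L m (n + 1)) => (1 : 𝔸ˣ)))
              (S := adTransportW φ fun _ : Bond d (towerP L m (n + 1)) => (1 : 𝔸ˣ)⁻¹) (Δ₁ := hessOp φ η (fun _ : Bond d (towerP L m (n + 1)) => (1 : 𝔸ˣ)) τ)
              (Rr := RofUk L m n φ η (fun _ : Bond d (towerP L m (n + 1)) => (1 : 𝔸ˣ)))
              (Q := (QkW L m n φ (fun _ : Bond d (towerP L m (n + 1)) => (1 : 𝔸ˣ)) hL (fun _ => 0) (fun _ => by norm_num)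
                (perCfg_UlevOf_one_mem_U1 L m (n + 1)) (norm_Wcx_UlevOf_one_sub_one_le L m (n + 1) (fun _ => 0) (fun _ => le_rfl)) (c₀ := c₀) (c₁ := c₁))) (a := a)
              φ hpos₁ hQ1 lev₁ (nabla115 η (fun _ : Bond d (towerP L m (n + 1)) => (1 : 𝔸ˣ)))) 0 W₂ 0
            (fun A' => A' + solA (H1LatticeCLM (L := (L : ℝ)) (η := η) (lev₀ := lev₀) (levB := levB) (c := ((η : ℂ))⁻¹)
              (R := adTransportW φ (fun _ : Bond d (towerP L m (n + 1)) => (1 : 𝔸ˣ)))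
              (S := adTransportW φ fun _ : Bond d (towerP L m (n + 1)) => (1 : 𝔸ˣ)⁻¹) (Δ₁ := hessOp φ η (fun _ : Bond d (towerP L m (n + 1)) => (1 : 𝔸ˣ)) τ)
              (Rr := RofUk L m n φ η (fun _ : Bond d (towerP L m (n + 1)) => (1 : 𝔸ˣ)))
              (Q := (QkW L m n φ (fun _ : Bond d (towerP L m (n + 1)) => (1 : 𝔸ˣ)) hL (fun _ => 0) (fun _ => by norm_num)
                (perCfg_UlevOf_one_mem_U1 L m (n + 1)) (norm_Wcx_UlevOf_one_sub_one_le L m (n + 1) (fun _ => 0) (fun _ => le_rfl)) (c₀ := c₀) (c₁ := c₁))) (a := a)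
              φ hpos₁ hQ1 lev₁ (nabla115 η (fun _ : Bond d (towerP L m (n + 1)) => (1 : 𝔸ˣ)))) 0
              (Cck L m η (n + 1) (fun _ : Bond d (towerP L m (n + 1)) => (1 : 𝔸ˣ)) lev₀ lev₁ (nabla115 η (fun _ : Bond d (towerP L m (n + 1)) => (1 : 𝔸ˣ))) levB) 0 εC' A') ε₄'
            (H1LatticeCLM (L := (L : ℝ)) (η := η) (lev₀ := lev₀) (levB := levB) (c := ((η : ℂ))⁻¹)
              (R := adTransportW φ (fun _ : Bond d (towerP L m (n + 1)) => (1 : 𝔸ˣ)))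
              (S := adTransportW φ fun _ : Bond d (towerP L m (n + 1)) => (1 : 𝔸ˣ)⁻¹) (Δ₁ := hessOp φ η (fun _ : Bond d (towerP L m (n + 1)) => (1 : 𝔸ˣ)) τ)
              (Rr := RofUk L m n φ η (fun _ : Bond d (towerP L m (n + 1)) => (1 : 𝔸ˣ)))
              (Q := (QkW L m n φ (fun _ : Bond d (towerP L m (n + 1)) => (1 : 𝔸ˣ)) hL (fun _ => 0) (fun _ => by norm_num)
                (perCfg_UlevOf_one_mem_U1 L m (n + 1)) (norm_Wcx_UlevOf_one_sub_one_le L m (n + 1) (fun _ => 0) (fun _ => le_rfl)) (c₀ := c₀) (c₁ := c₁))) (a := a)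
              φ hpos₁ hQ1 lev₁ (nabla115 η (fun _ : Bond d (towerP L m (n + 1)) => (1 : 𝔸ˣ)))) B‖ ≤
          1 / (1 - 4 * bC' * C₂c' * (ρC + sC)) *
              (((max ((NegSup.wSup (levWeight (L : ℝ) η lev₀ 1) : ℝ) * (Mφ * ((j₀ + α) * KG) * Mφ')) (NegSup.wSup (levWeight (L : ℝ) η lev₁ 2) * (Mφ * ((j₀ + α) * KD) * Mφ')) *
                    NegSup.wInvSup (levWeight (L : ℝ) η lev₀ 3)) * (jr + C₄ * (ε₄ + ar) ^ 2) + 0 * (ε₄ + ar) + B₀' * δW +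
                (max ((NegSup.wSup (levWeight (L : ℝ) η lev₀ 1) : ℝ) * (Mφ * ((j₀ + α) * KA) * Mφ')) (NegSup.wSup (levWeight (L : ℝ) η lev₁ 2) * (Mφ * ((j₀ + α) * KA) * Mφ')) *
                    NegSup.wInvSup (levWeight (L : ℝ) η levB 0)) * ‖B‖) / (1 - (θ' + 4 * B₀' * C₄' * (ρ + s)))) +
            ((max ((NegSup.wSup (levWeight (L : ℝ) η lev₀ 1) : ℝ) * (Mφ * ((j₀ + α) * KA) * Mφ')) (NegSup.wSup (levWeight (L : ℝ) η lev₁ 2) * (Mφ * ((j₀ + α) * KA) * Mφ')) *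
                  NegSup.wInvSup (levWeight (L : ℝ) η levB 0)) * (C₂c * (εC + aC) ^ 2) + bC' * δC) / (1 - 4 * bC' * C₂c' * (ρC + sC)) :=
  exists_chartHB_lipschitz_at_flat_latticeFree_of_omegaHolder hd L hL hL3 φ hMφ hMφ' hφ hφ' hstar ha ha' hϱ0 hϱ1 τ hτ hCτ hτm hMτ hρw hτ₁ hτ₂ hφτ AQ b hM₂ hrepr
    (exists_holderLetter_RkGpDstar_sub_flat hd L hL hL3 φ hMφ hMφ' hφ hφ' ha ha' hϱ0 hϱ1 τ hτ hCτ hMτ hρw hτ₁ hτ₂ hφτ AQ b hM₂ hrepr)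

end Literature.MathematicalPhysics.QuantumFieldTheory.Balaban1983to89.B11Eq174ChartLipschitzAtFlatLatticeFreeClosed

end
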